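import Literature.MathematicalPhysics.QuantumFieldTheory.SUNBakryEmeryPoincare
import Literature.MathematicalPhysics.QuantumFieldTheory.SUNBakryEmeryDiracKernel
import Mathlib.Analysis.Calculus.ParametricIntegral
import Mathlib.MeasureTheory.Group.Integral
import HarnessLib

/-!
# Polynomial smoothing kernels on `M_N(ℂ)`: the Landau–Weierstrass construction

For a continuous compactly supported `v : M_N(ℂ) → ℝ` the Landau-smoothed function
`P(x) = ∫ v(y) · c (R² − ‖x − y‖_F²)^k dy` is a POLYNOMIAL of degree `≤ 2k` in the real coordinates of `x`
(`integral_mul_landau_mem_polySpace`), and near the origin it is the genuine convolution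
`∫_{‖z‖≤ρ} c(R² − ‖z‖²)^k v(x − z) dz` (`integral_mul_landau_eq_setIntegral`), whose derivative is the convolution of
the derivative (`hasFDerivAt_setIntegral_landau`).  This is the mechanism of the Landau–Lang proof of the Weierstrass
approximation theorem (S. Lang, *Math Talks for Undergraduates* (1999), pp. 36–38), in several variables and with one
derivative, used in `SUNBakryEmeryWeierstrass.lean` to approximate smooth functions on `SU(N)` by polynomials in `C¹`.

Theorems only; no definition.  The Frobenius norm instances (`Matrix.Norms.Frobenius`) are used, as in the rest of the
`SUNBakryEmery` files.

## References

* S. Lang, *Math Talks for Undergraduates*, Springer (1999), «Dirac sequences», pp. 36–38 [Lang1999MathTalks].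
-/

noncomputable section

open scoped Matrix ComplexConjugate BigOperators

namespace Literature.MathematicalPhysics.QuantumFieldTheory

namespace SUNBakryEmery

open scoped Matrix.Norms.Frobenius ContDiff Topology
open Matrix Complex Finset MeasureTheory Filter Set Metric

variable {N : ℕ}

/-! ### The Frobenius norm in real coordinates -/

/-- `‖z‖_F² = ∑_κ coordinate_κ(z)²` over the real coordinates `Re z_{ab}`, `Im z_{ab}`.
[cite: arXiv220412737, §2 (2.3) (p. 10)] -/
theorem norm_sq_eq_sum_coordFn (z : Matrix (Fin N) (Fin N) ℂ) : ‖z‖ ^ 2 = ∑ κ : CoordIdx N, coordFn κ z ^ 2 := by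
  rw [← frobNorm_eq_norm, frobNorm_sq]
  simp only [CoordIdx, Fintype.sum_prod_type, Fintype.sum_bool, coordFn_true, coordFn_false]
  refine sum_congr rfl fun a _ => sum_congr rfl fun b _ => ?_
  rw [Complex.sq_norm, Complex.normSq_apply]
  ring

/-! ### The Landau-smoothed function is a polynomial -/

/-- Products of `k` elements of `𝒫_2` lie in `𝒫_{2k}`. [cite: Lang1999MathTalks, Landau sequence p. 38 (proof device)] -/
theorem prod_mem_polySpace_two {ι : Type*} (m : ι → Matrix (Fin N) (Fin N) ℂ → ℝ) (hm : ∀ l, m l ∈ polySpace N 2) :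
    ∀ (k : ℕ) (p : Fin k → ι), (fun x => ∏ i, m (p i) x) ∈ polySpace N (2 * k) := by
  intro k
  induction k with
  | zero =>
      intro p
      simpa using const_mem_polySpace (N := N) 0 1
  | succ k ih =>
      intro p
      have h := mul_mem_polySpace (hm (p 0)) (ih (fun i => p i.succ))
      have e : (fun x => ∏ i : Fin (k + 1), m (p i) x) = m (p 0) * fun x => ∏ i : Fin k, m (p i.succ) x := by
        funext x
        rw [Fin.prod_univ_succ]
        rfl
      rw [e, show 2 * (k + 1) = 2 + 2 * k by ring]
      exact h

/-- **The Landau-smoothed function is a polynomial**: for continuous compactly supported `v` and a measure finite on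
compacts, `x ↦ ∫ v(y)·c(R² − ‖x − y‖²)^k dμ(y)` belongs to `𝒫_{2k}` (expand
`R² − ‖x−y‖² = (R² − ‖y‖²)·1 + ∑_κ 2y_κ·x_κ + ∑_κ (−1)·x_κ²`, raise to the `k`-th power, integrate termwise).
[cite: Lang1999MathTalks, Landau sequence p. 38 (proof device)] -/
theorem integral_mul_landau_mem_polySpace [MeasurableSpace (Matrix (Fin N) (Fin N) ℂ)]
    [BorelSpace (Matrix (Fin N) (Fin N) ℂ)] (μ : Measure (Matrix (Fin N) (Fin N) ℂ)) [IsFiniteMeasureOnCompacts μ]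
    {v : Matrix (Fin N) (Fin N) ℂ → ℝ} (hv : Continuous v) (hvs : HasCompactSupport v) (R c : ℝ) (k : ℕ) :
    (fun x => ∫ y, v y * (c * (R ^ 2 - ‖x - y‖ ^ 2) ^ k) ∂μ) ∈ polySpace N (2 * k) := by
  classical
  -- the expansion `R² − ‖x − y‖² = ∑_l a_l(y) m_l(x)` over `L = Option (CoordIdx N × Bool)`
  set L := Option (CoordIdx N × Bool)
  set a : L → Matrix (Fin N) (Fin N) ℂ → ℝ := fun l y =>
    Option.elim l (R ^ 2 - ∑ κ : CoordIdx N, coordFn κ y ^ 2) fun q => bif q.2 then 2 * coordFn q.1 y else -1 with ha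
  set m : L → Matrix (Fin N) (Fin N) ℂ → ℝ := fun l x =>
    Option.elim l 1 fun q => bif q.2 then coordFn q.1 x else coordFn q.1 x ^ 2 with hm
  have hsub : ∀ (κ : CoordIdx N) (x y : Matrix (Fin N) (Fin N) ℂ), coordFn κ (x - y) = coordFn κ x - coordFn κ y := by
    intro κ x y
    simp only [coordFn, Matrix.sub_mul, Matrix.trace_sub, Complex.sub_re]
  have hRHS : ∀ x y, ∑ l, a l y * m l x =
      (R ^ 2 - ∑ κ : CoordIdx N, coordFn κ y ^ 2) * 1 +
        ∑ κ : CoordIdx N, (2 * coordFn κ y * coordFn κ x + (-1) * coordFn κ x ^ 2) := by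
    intro x y
    rw [Fintype.sum_option, Fintype.sum_prod_type]
    simp only [ha, hm, Option.elim, Fintype.sum_bool, cond_true, cond_false]
  have hexp : ∀ x y, R ^ 2 - ‖x - y‖ ^ 2 = ∑ l, a l y * m l x := by
    intro x y
    rw [hRHS, norm_sq_eq_sum_coordFn]
    simp only [hsub]
    have e : ∑ κ : CoordIdx N, (coordFn κ x - coordFn κ y) ^ 2 =
        ∑ κ : CoordIdx N, coordFn κ y ^ 2 - ∑ κ : CoordIdx N, (2 * coordFn κ y * coordFn κ x + (-1) * coordFn κ x ^ 2) := by
      rw [← Finset.sum_sub_distrib]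
      exact sum_congr rfl fun κ _ => by ring
    rw [e]
    ring
  -- each `m_l` is in `𝒫_2`
  have hm2 : ∀ l, m l ∈ polySpace N 2 := by
    rintro (_ | ⟨κ, _ | _⟩)
    · exact const_mem_polySpace 2 1
    · have h := mul_mem_polySpace (coordFn_mem_polySpace le_rfl κ) (coordFn_mem_polySpace le_rfl κ)
      have e : m (some (κ, false)) = coordFn κ * coordFn κ := by
        funext x; simp [hm, sq]
      rw [e]; exact h
    · have e : m (some (κ, true)) = coordFn κ := by funext x; simp [hm]
      rw [e]; exact coordFn_mem_polySpace (by norm_num) κ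
  -- continuity of the coefficients
  have hcoord : ∀ κ : CoordIdx N, Continuous (coordFn (N := N) κ) := fun κ => continuous_of_contDiff (contDiff_coordFn κ)
  have hac : ∀ l, Continuous (a l) := by
    rintro (_ | ⟨κ, _ | _⟩)
    · show Continuous fun y => R ^ 2 - ∑ κ : CoordIdx N, coordFn κ y ^ 2
      exact continuous_const.sub (continuous_finsetSum _ fun κ _ => (hcoord κ).pow 2)
    · show Continuous fun _ : Matrix (Fin N) (Fin N) ℂ => (-1 : ℝ)
      exact continuous_const
    · show Continuous fun y => 2 * coordFn κ y
      exact continuous_const.mul (hcoord κ)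
  -- expand the power
  have hpow : ∀ x y, (c * (R ^ 2 - ‖x - y‖ ^ 2) ^ k) =
      ∑ p ∈ Fintype.piFinset (fun _ : Fin k => (univ : Finset L)), c * ((∏ i, a (p i) y) * ∏ i, m (p i) x) := by
    intro x y
    rw [hexp x y, Finset.sum_pow', Finset.mul_sum]
    refine sum_congr rfl fun p _ => ?_
    rw [Finset.prod_mul_distrib]
  -- the function as a finite combination of the `∏ m`
  have hfun : (fun x => ∫ y, v y * (c * (R ^ 2 - ‖x - y‖ ^ 2) ^ k) ∂μ) =
      ∑ p ∈ Fintype.piFinset (fun _ : Fin k => (univ : Finset L)),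
        (∫ y, v y * (c * ∏ i, a (p i) y) ∂μ) • fun x => ∏ i, m (p i) x := by
    funext x
    have hint : ∀ p : Fin k → L, Integrable (fun y => v y * (c * ((∏ i, a (p i) y) * ∏ i, m (p i) x))) μ := by
      intro p
      have hcont : Continuous fun y => v y * (c * ((∏ i, a (p i) y) * ∏ i, m (p i) x)) :=
        hv.mul (continuous_const.mul ((continuous_finsetProd _ fun i _ => hac (p i)).mul continuous_const))
      exact hcont.integrable_of_hasCompactSupport (hvs.mul_right)
    simp only [hpow, Finset.mul_sum, Finset.sum_apply, Pi.smul_apply, smul_eq_mul]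
    rw [integral_finsetSum _ fun p _ => hint p]
    refine sum_congr rfl fun p _ => ?_
    rw [← integral_mul_const]
    refine integral_congr_ae (ae_of_all _ fun y => ?_)
    ring
  rw [hfun]
  exact Submodule.sum_mem _ fun p _ => Submodule.smul_mem _ _ (prod_mem_polySpace_two m hm2 k p)

/-! ### Near the origin the smoothed function is a convolution over a ball -/

/-- For `‖x‖ ≤ r₁`, `v = 0` outside `closedBall 0 r₂` and `r₁ + r₂ ≤ ρ`:
`∫ v(y) K(x − y) dμ(y) = ∫_{closedBall 0 ρ} K(z) v(x − z) dμ(z)` for a translation- and reflection-invariant `μ`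
(change of variables `y = x − z`; the integrand vanishes for `‖z‖ > ρ`). [cite: Lang1999MathTalks, Dirac sequences p. 36–37 (proof device)] -/
theorem integral_mul_kernel_eq_setIntegral [MeasurableSpace (Matrix (Fin N) (Fin N) ℂ)]
    [BorelSpace (Matrix (Fin N) (Fin N) ℂ)] (μ : Measure (Matrix (Fin N) (Fin N) ℂ))
    [μ.IsAddLeftInvariant] [μ.IsNegInvariant]
    {v K : Matrix (Fin N) (Fin N) ℂ → ℝ} {r₁ r₂ ρ : ℝ} (hρ : r₁ + r₂ ≤ ρ)
    (hvr : ∀ y, r₂ < ‖y‖ → v y = 0) {x : Matrix (Fin N) (Fin N) ℂ} (hx : ‖x‖ ≤ r₁) :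
    ∫ y, v y * K (x - y) ∂μ = ∫ z in closedBall 0 ρ, K z * v (x - z) ∂μ := by
  have h1 : ∫ y, v y * K (x - y) ∂μ = ∫ z, v (x - z) * K (x - (x - z)) ∂μ :=
    (integral_sub_left_eq_self (fun y => v y * K (x - y)) μ x).symm
  rw [h1]
  simp_rw [sub_sub_cancel]
  rw [← setIntegral_eq_integral_of_forall_compl_eq_zero (s := closedBall (0 : Matrix (Fin N) (Fin N) ℂ) ρ)]
  · exact integral_congr_ae (ae_of_all _ fun z => mul_comm _ _)
  · intro z hz
    rw [mem_closedBall_zero_iff, not_le] at hz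
    have hxz : r₂ < ‖x - z‖ := by
      have := norm_sub_norm_le z x
      rw [norm_sub_rev] at this
      linarith
    rw [hvr _ hxz, zero_mul]

/-! ### Derivative of the convolution over a ball, along a line -/

/-- **Differentiating the convolution along a line**: for `v ∈ C¹` with compact support and continuous `K`,
`t ↦ ∫_{closedBall 0 ρ} K(z) v(x₀ + t·w − z) dμ(z)` has derivative `∫_{closedBall 0 ρ} K(z) Dv(x₀ − z)[w] dμ(z)` at
`t = 0` (dominated differentiation; the derivative of the convolution is the convolution of the derivative).
[cite: Lang1999MathTalks, Dirac sequences p. 36–37 (proof device)] -/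
theorem hasDerivAt_setIntegral_kernel_line [MeasurableSpace (Matrix (Fin N) (Fin N) ℂ)]
    [BorelSpace (Matrix (Fin N) (Fin N) ℂ)] (μ : Measure (Matrix (Fin N) (Fin N) ℂ)) [IsFiniteMeasureOnCompacts μ]
    {v : Matrix (Fin N) (Fin N) ℂ → ℝ} (hv : ContDiff ℝ 1 v) (hvs : HasCompactSupport v)
    {K : Matrix (Fin N) (Fin N) ℂ → ℝ} (hK : Continuous K) (ρ : ℝ) (x₀ w : Matrix (Fin N) (Fin N) ℂ) :
    HasDerivAt (fun t : ℝ => ∫ z in closedBall (0 : Matrix (Fin N) (Fin N) ℂ) ρ, K z * v (x₀ + t • w - z) ∂μ)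
      (∫ z in closedBall (0 : Matrix (Fin N) (Fin N) ℂ) ρ, K z * fderiv ℝ v (x₀ - z) w ∂μ) 0 := by
  -- the Frobenius-norm topology is (definitionally) the product topology: transport the two instances
  haveI : @OpensMeasurableSpace (Matrix (Fin N) (Fin N) ℂ) (matTop N) _ :=
    ‹BorelSpace (Matrix (Fin N) (Fin N) ℂ)›.opensMeasurable
  haveI : @IsFiniteMeasureOnCompacts (Matrix (Fin N) (Fin N) ℂ) _ (matTop N) μ := ‹IsFiniteMeasureOnCompacts μ›
  set B := closedBall (0 : Matrix (Fin N) (Fin N) ℂ) ρ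
  have hBc : IsCompact B := isCompact_closedBall _ _
  haveI : IsFiniteMeasure (μ.restrict B) := isFiniteMeasure_restrict.2 hBc.measure_lt_top.ne
  have hvc : Continuous v := hv.continuous
  -- the scalar derivative `y ↦ Dv(y)[w]`: continuous with compact support, hence bounded
  have hdc : Continuous fun y => fderiv ℝ v y w :=
    (hv.continuous_fderiv_apply one_ne_zero).comp (continuous_id.prodMk continuous_const)
  have hds : HasCompactSupport fun y => fderiv ℝ v y w :=
    (hvs.fderiv (𝕜 := ℝ)).comp_left (g := fun L : Matrix (Fin N) (Fin N) ℂ →L[ℝ] ℝ => L w) rfl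
  obtain ⟨CK, hCK⟩ := hBc.exists_bound_of_continuousOn hK.continuousOn
  obtain ⟨CV, hCV⟩ := hdc.bounded_above_of_compact_support hds
  have hline : ∀ (t : ℝ) (z : Matrix (Fin N) (Fin N) ℂ), HasDerivAt (fun s : ℝ => x₀ + s • w - z) w t := by
    intro t z
    have h1 : HasDerivAt (fun s : ℝ => s • w) ((1 : ℝ) • w) t := (hasDerivAt_id t).smul_const w
    rw [one_smul] at h1
    exact (h1.const_add x₀).sub_const z
  have h := hasDerivAt_integral_of_dominated_loc_of_deriv_le (μ := μ.restrict B) (s := ball (0 : ℝ) 1)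
    (F := fun (t : ℝ) z => K z * v (x₀ + t • w - z)) (F' := fun (t : ℝ) z => K z * fderiv ℝ v (x₀ + t • w - z) w)
    (x₀ := 0) (bound := fun _ => ‖CK‖ * CV) (ball_mem_nhds 0 zero_lt_one) ?_ ?_ ?_ ?_ ?_ ?_
  · simpa using h.2
  · exact Eventually.of_forall fun t =>
      (hK.mul (hvc.comp ((continuous_const.add continuous_const).sub continuous_id))).aestronglyMeasurable
  · exact (hK.mul (hvc.comp ((continuous_const.add continuous_const).sub continuous_id))).continuousOn.integrableOn_compact
      hBc
  · exact (hK.mul (hdc.comp ((continuous_const.add continuous_const).sub continuous_id))).aestronglyMeasurable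
  · refine (ae_restrict_iff' measurableSet_closedBall).2 (ae_of_all _ fun z hz t _ => ?_)
    rw [norm_mul]
    have h1 : ‖K z‖ ≤ ‖CK‖ := (hCK z hz).trans (le_abs_self CK)
    exact mul_le_mul h1 (hCV _) (norm_nonneg _) (norm_nonneg _)
  · exact integrable_const _
  · refine ae_of_all _ fun z t _ => ?_
    have hd : HasFDerivAt v (fderiv ℝ v (x₀ + t • w - z)) (x₀ + t • w - z) :=
      (hv.differentiable one_ne_zero _).hasFDerivAt
    exact (hd.comp_hasDerivAt t (hline t z)).const_mul (K z)

/-- **`D_A` of the Landau-smoothed function near the origin**: with `P(x) = ∫ v(y) K(x−y) dμ(y)` differentiable at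
`x₀`, `‖x₀‖ < r₁`, `v = 0` outside `closedBall 0 r₂`, `r₁ + r₂ ≤ ρ`:
`D_A P(x₀) = ∫_{closedBall 0 ρ} K(z) · Dv(x₀ − z)[x₀ A] dμ(z)` (compare the derivative of `P` and of the convolution
along the line `t ↦ x₀ + t·x₀A`, on which they agree for small `t`). [cite: Lang1999MathTalks, Dirac sequences p. 36–37 (proof device)] -/
theorem matD_integral_mul_kernel [MeasurableSpace (Matrix (Fin N) (Fin N) ℂ)]
    [BorelSpace (Matrix (Fin N) (Fin N) ℂ)] (μ : Measure (Matrix (Fin N) (Fin N) ℂ)) [IsFiniteMeasureOnCompacts μ]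
    [μ.IsAddLeftInvariant] [μ.IsNegInvariant]
    {v : Matrix (Fin N) (Fin N) ℂ → ℝ} (hv : ContDiff ℝ 1 v) (hvs : HasCompactSupport v)
    {K : Matrix (Fin N) (Fin N) ℂ → ℝ} (hK : Continuous K) {r₁ r₂ ρ : ℝ} (hρ : r₁ + r₂ ≤ ρ)
    (hvr : ∀ y, r₂ < ‖y‖ → v y = 0) {x₀ : Matrix (Fin N) (Fin N) ℂ} (hx₀ : ‖x₀‖ < r₁)
    (hP : DifferentiableAt ℝ (fun x => ∫ y, v y * K (x - y) ∂μ) x₀) (A : Matrix (Fin N) (Fin N) ℂ) :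
    matD A (fun x => ∫ y, v y * K (x - y) ∂μ) x₀ =
      ∫ z in closedBall (0 : Matrix (Fin N) (Fin N) ℂ) ρ, K z * fderiv ℝ v (x₀ - z) (x₀ * A) ∂μ := by
  set B := closedBall (0 : Matrix (Fin N) (Fin N) ℂ) ρ
  set w := x₀ * A
  -- derivative of `P` along the line
  have hline : HasDerivAt (fun s : ℝ => x₀ + s • w) w 0 := by
    have h1 : HasDerivAt (fun s : ℝ => s • w) ((1 : ℝ) • w) 0 := (hasDerivAt_id (0 : ℝ)).smul_const w
    rw [one_smul] at h1
    exact h1.const_add x₀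
  have h1 : HasDerivAt (fun s : ℝ => (fun x => ∫ y, v y * K (x - y) ∂μ) (x₀ + s • w))
      (fderiv ℝ (fun x => ∫ y, v y * K (x - y) ∂μ) x₀ w) 0 :=
    hP.hasFDerivAt.comp_hasDerivAt_of_eq (0 : ℝ) hline (by simp)
  -- derivative of the convolution along the line
  have h2 := hasDerivAt_setIntegral_kernel_line μ hv hvs hK ρ x₀ w
  -- the two functions of `s` agree near `0`
  have hev : (fun s : ℝ => (fun x => ∫ y, v y * K (x - y) ∂μ) (x₀ + s • w)) =ᶠ[𝓝 0]
      fun s : ℝ => ∫ z in B, K z * v (x₀ + s • w - z) ∂μ := by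
    have hcont : Continuous fun s : ℝ => ‖x₀ + s • w‖ := (continuous_const.add (continuous_id.smul continuous_const)).norm
    have h0 : ‖x₀ + (0 : ℝ) • w‖ < r₁ := by simpa using hx₀
    have hlt : ∀ᶠ s : ℝ in 𝓝 0, ‖x₀ + s • w‖ < r₁ := (hcont.tendsto 0).eventually_lt_const h0
    filter_upwards [hlt] with s hs
    exact integral_mul_kernel_eq_setIntegral μ hρ hvr hs.le
  have h3 : HasDerivAt (fun s : ℝ => (fun x => ∫ y, v y * K (x - y) ∂μ) (x₀ + s • w))
      (∫ z in B, K z * fderiv ℝ v (x₀ - z) w ∂μ) 0 := h2.congr_of_eventuallyEq hev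
  rw [matD_apply]
  exact h1.unique h3

end SUNBakryEmery

end Literature.MathematicalPhysics.QuantumFieldTheory
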